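import Literature.MathematicalPhysics.QuantumFieldTheory.Balaban1983to89.B4

/-!
# `Balaban1983to89.B1` — T. Bałaban, *(Higgs)₂,₃ quantum fields in a finite volume. I. A lower bound*,
Commun. Math. Phys. **85**, 603–626 (1982).  (INDEX: B1 = ref [1] of B4 (CMP 89:571), ref [5] of B12, ref [8] of B10;
CONTEXT paper of the Yang–Mills series B4 → … → B16, not a node of its DAG.)
PDF held: `paper:balaban1982-cmp85-higgs23-i` (journal page = PDF page + 602).

CITATION HEADER (lean-in-tree rule 2026-08-18). This module is a TYPED SKELETON (statement level) of exactly those items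
of the published paper T. Bałaban, "(Higgs)₂,₃ quantum fields in a finite volume. I. A lower bound", *Comm. Math.
Phys.* **85**, 603–626 (1982) [Balaban1982Higgs1] that the Yang–Mills series cites by number: Propositions 2.1, 2.2, 2.3
pp. 610–612 [PDF 8–10] ((2.22)–(2.38)) — the ORIGINALS of the restatements "Theorem (Proposition 2.1 of [1])" p. 573 and
"Proposition 2.3 of [1]" p. 574 of B4 = [Balaban1983RegularityDecay] (typed there as `B4.ThmPrinted`,
`B4.Prop23Printed`) — and the renormalization-group recursion (2.42) / formula (2.43) p. 612 [PDF 10] (imported by B4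
p. 582 as "(2.34) … renormalization group equations (2.43) of [1]", cell census G-B4-06(b)).  STATUS IN PRINT: B1 states
Props 2.1–2.3 WITHOUT proof (p. 604 [PDF 2]: *"This and the next papers contain the main ideas of our proof, while many
technical results are postponed for later papers."*; p. 611: Props 2.2–2.3 are *"some consequences of the above theorem"*
[= Prop. 2.1]); the proofs are B4's.  WHAT IS REPRODUCED: every statement verbatim from the ×2 page renders
`HOME/b2b-balaban-ref1/pages/1982-cmp85-higgs23-I/…-p008…p010-x2.png` (NOT the OCR layer, which e.g. inverts "d, a, M
only, c₀ on α also" into "d, α, M only, c₀ on a also" on p. 610), as `def …Printed : Prop` over the SAME abstract carriers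
as B4 (`B4.EtaSetting` for Prop. 2.1, `B4.UnitSetting` for Prop. 2.3; a new `DeltaSetting` for Prop. 2.2) under the
explicit DICTIONARY below, so that the comparison with B4's restatements is a kernel statement over one family of
instances: `prop21Printed_iff_thmPrinted` (clause for clause, INCLUDING the δG localisation factor: B1 prints
"exp(−δ₀ dist(supp f, Ωᶜ) − δ₀ dist({x,x′}, Ωᶜ))" where B4 (1.12) misprints the same distance twice — B1's original =
the cell's repaired reading D-b04.2 of census G-B4-01, certification C-pv07-1), `prop23Intended_iff_prop23Printed`
(`Iff.rfl`) and `prop23Printed_of_literal` (B1's Prop. 2.3 prints NO "for e sufficiently small"; B4's restatement adds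
it and is the weaker statement — DIVERGENCE D-pv07.2).  Word-level divergences of the restatements (constants "depending
on d, a, M only" (B1 Prop. 2.1) / "dependent on d and a" (B1 Prop. 2.3) vs "d, M only" / "d and M only" (B4); setting
T_η, Ω = B^k(Ω^{(k)}), e(L^kε), m²(L^kε)², a_k (B1) vs ηZ^d or T_η, e, m² ≥ 0, a (B4)) are the cell's DIVERGENCE rows
D-pv07.1–3; none changes a typed statement (d, a, M, L are fixed for a family of instances in both typings).
KERNEL-CHECKED here (elementary): the comparisons just named, `prop21Printed_of_uniform` (the finer literal quantifier
reading), and (2.42) ⇒ (2.43) (*"applying (2.42) k times … Using the identity G₁^ε(Ω,A) = C^{(0),ε}(Ω,A)"*) as a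
telescoping identity in an arbitrary additive commutative monoid of operators (`display243_of_242`).
DICTIONARY (B4 carrier field ↤ B1 object; B1 (1.2)–(1.3) p. 604: the torus T_ε with the sup-distance
|x − y| = max_μ min{|x_μ − y_μ|, 2L_μ − |x_μ − y_μ|}; η = L^{−k}; T_η, T₁^{(k)} its rescalings): `EtaSetting.e` ↤
e(L^kε) := e·(L^kε)^{(4−d)/2} (2.23); the mass of (1.6) ↤ m²(L^kε)² and the constant a of (1.6) ↤ a_k of (2.22)
G_k(Ω,A) = (−Δ^{η,N}_{A,Ω} + m²(L^kε)² + a_kP_k(A))^{−1}; `regular` ↤ (2.23) |(∂^η_μA)(x)| ≤ c(e(L^kε))^{β−1}, x ∈ Ω,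
μ = 1,…,d; `bigBlocks` ↤ "Ω = B^k(Ω^{(k)}) and Ω^{(k)} ⊂ T₁^{(k)} a sum of big blocks with M sufficiently large" (and
Ω₀ likewise, Ω ⊂ Ω₀, for the δG clause); `rect` ↤ "rectangular parallelepipeds"; `bdist…` ↤ distances to Ωᶜ = the
complement IN T_η (p. 611: *"Let us notice that Ωᶜ means a complement in T_η so in the case Ω = T_η the condition
dist({x,x′},Ωᶜ) ≥ R₀ is meaningless and is omitted"*); all kernels/norms as in `B4.EtaSetting` with G_k(Ω,A) of (2.22).
`UnitSetting` ↤ (2.31)–(2.32): C^{(k)}(Ω,A) = (aL^{−2}P(A) + Δ^{(k)}(Ω,A))^{−1}, C^{(k)}_Λ(Ω,A) = ((aL^{−2}P(A) +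
Δ^{(k)}(Ω,A))↾_Λ)^{−1}, A↾_Λφ = ΛAΛφ, *"Here we will assume that the set Λ is a union of big blocks of T₁^{(k)}"*,
`form115 γ₀ γ₁` ↤ (2.33) γ₀I ≤ aL^{−2}P(A) + Δ^{(k)}(Ω,A) ≤ γ₁I (summands printed in the opposite order to B4 (1.15)).
NOTHING of the paper is asserted: every `…Printed` Prop is consumed downstream only as a hypothesis; B1's own theorem
(the lower bound, (1.14)) and Sects. 3–6 are NOT reproduced (no node of the series cites them by number; B4's imports
"(I.3.15), (I.3.16), (I.3.44)" — census G-B4-06(a) — are expansion FORMULAS inside B4's proofs, left to the B4 census).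
Staged byte-identically in the cell package `run/shared/lean/pub/pub-balaban/lean/BalabanYm4/Literature/…/B1.lean`.
Unit `b2b-balaban-pv07` (surge seat; PHASE-2 row P00, journal claim `P00-B1B3`).  Companion records: cell DIVERGENCE.md
D-pv07.*, GAPS.md C-pv07-1 / G-pv07-*.
ADDENDUM (gen 2 of unit `b2b-balaban-pv07`, 2026-08-18; census G-B4-06 (a), (d); everything above this paragraph is
the gen-1 text, unchanged).  The clause above *"… left to the B4 census"* is SUPERSEDED for G-B4-06 (a)/(d): the operator
calculus of Sects. 1–3 that B4 imports by number is now typed in the section `## ADDENDUM (gen 2)` at the end of this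
file, verbatim from the ×2 renders `…-p003, p006, p007, p008, p012, p013, p017, p018-x2.png` (pp. 605, 608–610,
614–615, 619–620): U(A) and D^ε_A (1.7) p. 605, A(Γ) (2.3) and Q(A) (2.7) p. 608, Q_k(A) (2.11) and a_k
(2.13)–(2.15) p. 609, P_k(A) and G_k^ε(Ω,A), G_k(Ω,A) (2.20)/(2.22) p. 610, the expansions (3.14)–(3.15) p. 614, (3.16)
p. 615, (3.44) p. 619, (3.45) p. 620.  B4's CONSUMERS [Balaban1983RegularityDecay]: p. 579 *"Now we expand the
propagator G_k(□,A) with respect to A′. Using formula I.3.16 we have (2.24)"*; p. 580 the restated definitions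
*"F_{1,k}(A) = η^{−1}(U(A) − 1)"*, *"F′_{1,k}(A) = U(A) − 1"*, *"D^η_A = U(A′)D^η_{A₀} + F_{1,k}(A′)"*; p. 590 *"using
(I.3.15), (I.3.44)"*; (1.4)–(1.6) p. 572 (Q_k(A) with weight η^d = L^{−kd}, P_k(A) = Q_k^*(A)Q_k(A), G_k(Ω,A)).
KERNEL-CHECKED (elementary algebra;
nothing of the paper is asserted, no `…Printed` leaf is needed): (2.15) solves (2.13) with a₁ = a, is the unique such
sequence, decreases strictly to a_∞ = a(1 − L^{−2}) and satisfies a_∞ < a_k ≤ a (`aSeq_*`); (3.15) as the pointwise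
identity it is (`display315`, over the common shape `blockAvg` of (2.7)/(2.11)/B4 (1.4)); (3.16) as an identity in an
arbitrary *-ring of operators from the bondwise relations D_{A+B} = U(A)D_B + F_{1,k}(A), U(−A)F_{1,k}(A) = −F_{1,k}(−A),
U unitary, and (3.15) (`display316`); (3.44) ⇐ (3.16) + (2.22) as the resolvent identity (`display344_of_316`); (3.45)
⇐ (3.44) for every n̄ (`display345_of_344`); and B4 (2.24) ⇐ (3.16) at (A,B) := (A′,A₀), sandwiched by G_k^{1/2}(□,A₀)
(`B4display224_of_316`: the square bracket of B4 (2.24) IS the V_k of (3.44) — signs agree term by term; certification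
C-pv07-3).  NOT typed: the Taylor formula (3.14) with its remainder bound |R_{n̄+1}(qA)| ≤ 1 (p. 615) — B4 does not cite
it and re-derives its own bounds on F_{1,k}, F_{2,k} (p. 580).  Journal claim `P00-G-B4-06`.
-/

namespace Literature.MathematicalPhysics.QuantumFieldTheory.Balaban1983to89.B1

variable {I : Type}

/-! ## Proposition 2.1 (pp. 610–611): the η-lattice propagators G_k(Ω, A) -/

/-- (2.24)–(2.25) of Prop. 2.1 for one instance with constants (α, δ₀, c₀, R₀) — under the DICTIONARY of the module
docstring these two displays are character for character B4's (1.9)–(1.10) (B4 (1.10) prints "(G_k(Ω,A)(x)", B1 (2.25)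
the intended "(G_k(Ω,A)f)(x)"), so the B4 predicate is reused: (2.24) (1/|x−x′|^α)|U(A(Γ_{x,x′}))(D^η_{A,μ}G_k(Ω,A)f)(x′)
− (D^η_{A,μ}G_k(Ω,A)f)(x)| ≤ c₀exp(−δ₀dist({x,x′}, supp f))‖f‖_∞ "for x, x′ ∈ Ω and satisfying the condition
dist({x,x′},Ωᶜ) ≥ R₀"; (2.25) |(D^η_{A,μ}G_k(Ω,A)f)(x)|, |(G_k(Ω,A)f)(x)| ≤ c₀exp(−δ₀dist(x, supp f))‖f‖_∞ "for x ∈ Ω,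
dist(x,Ωᶜ) ≥ R₀"; the restriction waived for rectangular parallelepipeds. [cite: Balaban1982Higgs1, (2.24)–(2.25) p.610] -/
def Ineq224_225 (S : B4.EtaSetting) (α δ₀ c₀ R₀ : ℝ) : Prop :=
  B4.Ineq19_110 S α δ₀ c₀ R₀

/-- The δG clause of Prop. 2.1 for one instance (pp. 610–611, verbatim): *"If Ω ⊂ Ω₀, then for δG_k(Ω,Ω₀,A) defined by
the equality δG_k(Ω,Ω₀,A) = G_k(Ω,A) − G_k(Ω₀,A), (2.26) we have the inequalities (2.24), (2.25) with the additional
factor exp(−δ₀ dist(supp f, Ωᶜ) − δ₀ dist({x,x′}, Ωᶜ)) on the right sides."*  Typed LITERALLY: the right sides of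
(2.24)/(2.25) multiplied ON THE RIGHT by that factor, distances in the printed order (supp f first); in the one-point
inequalities (2.25) "{x,x′}" can only mean {x} (`bdist1`).  This is the ORIGINAL of B4 (1.11)–(1.12), whose print
repeats "dist(supp f, Ωᶜ)" twice (cell census G-B4-01; b04's repaired typing `B4.Ineq111_112` = D-b04.2) — see
`ineq226_iff_ineq111_112`. [cite: Balaban1982Higgs1, (2.26) pp.610–611] -/
def Ineq226 (S : B4.EtaSetting) (α δ₀ c₀ R₀ : ℝ) : Prop :=
  (∀ (μ : S.Dir) (f : S.Src) (x x' : S.Site), (S.rect ∨ R₀ ≤ S.bdist2 x x') →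
      S.dlhs19 α μ f x x' ≤ c₀ * Real.exp (-(δ₀ * S.sdist2 x x' f)) * S.supNorm f *
        Real.exp (-(δ₀ * S.bdistS f) - δ₀ * S.bdist2 x x')) ∧
  (∀ (μ : S.Dir) (f : S.Src) (x : S.Site), (S.rect ∨ R₀ ≤ S.bdist1 x) →
      S.dvalDG μ f x ≤ c₀ * Real.exp (-(δ₀ * S.sdist1 x f)) * S.supNorm f *
        Real.exp (-(δ₀ * S.bdistS f) - δ₀ * S.bdist1 x) ∧
      S.dvalG f x ≤ c₀ * Real.exp (-(δ₀ * S.sdist1 x f)) * S.supNorm f *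
        Real.exp (-(δ₀ * S.bdistS f) - δ₀ * S.bdist1 x))

/-- **Proposition 2.1** (pp. 610–611 [PDF 8–9], verbatim from the render): *"Let a set Ω satisfies Ω = B^k(Ω^{(k)}) and
let Ω^{(k)} ⊂ T₁^{(k)} be a sum of big blocks with M sufficiently large. Further, let a configuration A be regular on Ω
in the sense that |(∂^η_μA)(x)| ≤ c(e(L^kε))^{β−1}, x ∈ Ω, μ = 1,…,d, (2.23) where e(L^kε) = e(L^kε)^{(4−d)/2},
η = L^{−k}, β > 0 and c is some universal constant. For an arbitrary pair of points x, x′ ∈ T_η let us denote yb [sic]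
Γ_{x,x′} a shortest contour connecting these points. Then for e(L^kε) sufficiently small and α < 1 there exist positive
constants δ₀, c₀, R₀ independent of A, k, Ω and depending on d, a, M only, c₀ on α also, such that for an arbitrary
function f : Ω → R^N we have (2.24) for x, x′ ∈ Ω and satisfying the condition dist({x,x′},Ωᶜ) ≥ R₀. Similarly we have
(2.25) for x ∈ Ω, dist(x,Ωᶜ) ≥ R₀. If Ω ⊂ Ω₀, then for δG_k(Ω,Ω₀,A) defined by the equality (2.26) we have the
inequalities (2.24), (2.25) with the additional factor exp(−δ₀ dist(supp f, Ωᶜ) − δ₀ dist({x,x′}, Ωᶜ)) on the right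
sides. For some simple sets Ω, e.g. for rectangular parallelepipeds, the inequalities hold without any restrictions on
the points x,x′, i.e. for all x,x′ ∈ Ω."* (displays in `Ineq224_225`, `Ineq226`; G_k(Ω,A) = (−Δ^{η,N}_{A,Ω} + m²(L^kε)²
+ a_kP_k(A))^{−1} (2.22), P_k(A) = Q_k^*(A)Q_k(A) (2.20)).  Quantifier shape ALIGNED with `B4.ThmPrinted` (α, then
δ₀, c₀, R₀ and the smallness threshold e₁ on `EtaSetting.e` = e(L^kε), then the instance); the finer literal reading
"δ₀, R₀ depending on d, a, M only, c₀ on α also" is `Prop21Uniform`.  B4's restatement p. 573 drops "a" from "d, a, M"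
(DIVERGENCE D-pv07.1; no typed effect: a, resp. a_k ∝ a, is fixed for the family). [cite: Balaban1982Higgs1, Prop. 2.1 (2.23)–(2.26) pp.610–611] -/
def Prop21Printed (fam : I → B4.EtaSetting) : Prop :=
  ∀ α : ℝ, α < 1 → ∃ δ₀ c₀ R₀ e₁ : ℝ, 0 < δ₀ ∧ 0 < c₀ ∧ 0 < R₀ ∧ 0 < e₁ ∧ ∀ i : I,
    (fam i).regular → (fam i).bigBlocks → 0 < (fam i).e → (fam i).e ≤ e₁ →
      Ineq224_225 (fam i) α δ₀ c₀ R₀ ∧ Ineq226 (fam i) α δ₀ c₀ R₀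

/-- The finer LITERAL quantifier reading of Prop. 2.1: *"for e(L^kε) sufficiently small and α < 1 there exist positive
constants δ₀, c₀, R₀ … depending on d, a, M only, c₀ on α also"* — the smallness threshold and δ₀, R₀ are chosen BEFORE
α; only c₀ depends on α.  Implies `Prop21Printed` (`prop21Printed_of_uniform`); B4's sentence p. 573 ("depending on d,
M only, c₀ on α also") admits the same reading, b04 typed the weaker one. [cite: Balaban1982Higgs1, Prop. 2.1 p.610] -/
def Prop21Uniform (fam : I → B4.EtaSetting) : Prop :=
  ∃ δ₀ R₀ e₁ : ℝ, 0 < δ₀ ∧ 0 < R₀ ∧ 0 < e₁ ∧ ∀ α : ℝ, α < 1 → ∃ c₀ : ℝ, 0 < c₀ ∧ ∀ i : I,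
    (fam i).regular → (fam i).bigBlocks → 0 < (fam i).e → (fam i).e ≤ e₁ →
      Ineq224_225 (fam i) α δ₀ c₀ R₀ ∧ Ineq226 (fam i) α δ₀ c₀ R₀

/-- Ring/`exp` bookkeeping: B1's printed localisation factor, appended on the right with "dist(supp f, Ωᶜ)" first,
equals b04's repaired B4 factor (1.12) placed before ‖f‖_∞ with "dist({x,x′}, Ωᶜ)" first. [folklore] -/
theorem rhs_factor_eq (c₀ A N u v : ℝ) :
    c₀ * A * N * Real.exp (-u - v) = c₀ * A * Real.exp (-(v + u)) * N := by
  rw [show -u - v = -(v + u) by ring]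
  ring

/-- KERNEL-CHECKED COMPARISON (cell P00 target 1, δG clause): B1's printed (2.26)-clause = B4's (1.11)–(1.12) AS REPAIRED
by the cell (D-b04.2: one distance for the evaluation points, one for the source support) — i.e. the original paper
prints exactly the factor the B4 census G-B4-01 reconstructed from B4's proof (certification C-pv07-1). [folklore] -/
theorem ineq226_iff_ineq111_112 (S : B4.EtaSetting) (α δ₀ c₀ R₀ : ℝ) :
    Ineq226 S α δ₀ c₀ R₀ ↔ B4.Ineq111_112 S α δ₀ c₀ R₀ := by
  simp only [Ineq226, B4.Ineq111_112, rhs_factor_eq]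

/-- KERNEL-CHECKED COMPARISON (cell P00 target 1): under the DICTIONARY, B4's "Theorem (Proposition 2.1 of [1])" p. 573
as typed by b04 (`B4.ThmPrinted`, with the repaired (1.12)) is B1's Proposition 2.1 clause for clause. [folklore] -/
theorem prop21Printed_iff_thmPrinted (fam : I → B4.EtaSetting) :
    Prop21Printed fam ↔ B4.ThmPrinted fam := by
  simp only [Prop21Printed, B4.ThmPrinted, Ineq224_225, ineq226_iff_ineq111_112]

/-- The finer literal reading implies the aligned one (instantiate the α-uniform δ₀, R₀, e₁). [folklore] -/
theorem prop21Printed_of_uniform (fam : I → B4.EtaSetting) (h : Prop21Uniform fam) : Prop21Printed fam := by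
  obtain ⟨δ₀, R₀, e₁, hδ, hR, he, hα⟩ := h
  intro α hlt
  obtain ⟨c₀, hc, hi⟩ := hα α hlt
  exact ⟨δ₀, c₀, R₀, e₁, hδ, hc, hR, he, hi⟩

/-- Hence the finer reading of the original also yields B4's restatement. [folklore] -/
theorem thmPrinted_of_prop21Uniform (fam : I → B4.EtaSetting) (h : Prop21Uniform fam) : B4.ThmPrinted fam :=
  (prop21Printed_iff_thmPrinted fam).1 (prop21Printed_of_uniform fam h)

/-! ## Proposition 2.2 (p. 611): decay of the kernels of Δ^{(k)}(Ω, A) -/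

/-- Abstract carrier for Prop. 2.2: one INSTANCE = (k; Ω = B^k(Ω^{(k)}) ⊂ T_η, Ω^{(k)} ⊂ T₁^{(k)} a sum of big blocks,
and Ω₀ ⊃ Ω likewise for the δΔ clause; a configuration A; the charge parameter `e` = e(L^kε) of (2.23)).  `KSite` =
points of Ω^{(k)}; `udist x x′` = |x − x′| (unit lattice T₁^{(k)}); `distOc x` = dist(x, Ω^{(k)c}); `kerD x x′` =
|Δ^{(k)}(Ω,A; x,x′)|, the kernel of "the operator Δ^{(k),L^kε}(Ω,A) rescaled to the unit lattice" ((2.17)–(2.18),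
(2.21): Δ^{(0),ε}(Ω,A) = −Δ^{ε,N}_{A,Ω} + m²; ⟨ψ, Δ^{(k),L^kε}(Ω,A)ψ⟩ = a_k(L^kε)^{−2}⟨ψ,ψ⟩ − a_k²(L^kε)^{−4}⟨ψ,
Q_k(A)G^ε_k(Ω,A)Q_k^*(A)ψ⟩; = B4 (1.14) Δ^{(k)}(Ω,A) = a_kI − a_k²Q_k(A)G_k(Ω,A)Q_k^*(A)); `kerDD0 x x′` =
|δΔ^{(k)}(Ω,Ω₀,A; x,x′)| with (2.28) δΔ^{(k)}(Ω,Ω₀,A) = Δ^{(k)}(Ω,A) − Δ^{(k)}(Ω₀,A); predicates `regular` = (2.23) on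
Ω, `bigBlocks` as in Prop. 2.1. [cite: Balaban1982Higgs1, (2.17)–(2.21), (2.27)–(2.29) pp.610–611] -/
structure DeltaSetting where
  KSite : Type
  e : ℝ
  regular : Prop
  bigBlocks : Prop
  udist : KSite → KSite → ℝ
  distOc : KSite → ℝ
  kerD : KSite → KSite → ℝ
  kerDD0 : KSite → KSite → ℝ

/-- (2.27) and (2.29) for one instance with constants (δ₀, c₀). [cite: Balaban1982Higgs1, (2.27)–(2.29) p.611] -/
def Ineq227_229 (S : DeltaSetting) (δ₀ c₀ : ℝ) : Prop :=
  (∀ x x' : S.KSite, S.kerD x x' ≤ c₀ * Real.exp (-(δ₀ * S.udist x x'))) ∧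
  (∀ x x' : S.KSite, S.kerDD0 x x' ≤ c₀ * Real.exp (-(δ₀ * (S.udist x x' + S.distOc x + S.distOc x'))))

/-- **Proposition 2.2** (p. 611 [PDF 9], verbatim; announced as the first of *"some consequences of the above theorem.
The first concerns the operator Δ^{(k),L^kε}(Ω,A) rescaled to the unit lattice"*): *"If a configuration A is regular in
the same sense as in Proposition 2.1 then there exist constants δ₀ > 0 and c₀, depending on the same quantities as in
Proposition 2.1, such that |Δ^{(k)}(Ω,A;x,x′)| ≤ c₀exp(−δ₀|x−x′|), x,x′ ∈ Ω^{(k)}. (2.27) Putting for Ω ⊂ Ω₀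
δΔ^{(k)}(Ω,Ω₀,A) = Δ^{(k)}(Ω,A) − Δ^{(k)}(Ω₀,A), (2.28) the following inequality holds |δΔ^{(k)}(Ω,Ω₀,A;x,x′)| ≤
c₀ exp(−δ₀(|x−x′| + dist(x,Ω^{(k)c}) + dist(x′,Ω^{(k)c}))). (2.29)"*  LITERAL typing: the statement prints no
smallness clause on e(L^kε) (it is inherited from Prop. 2.1 only through "consequences of the above theorem"): this decl
has none; `Prop22Small` adds the inherited threshold.  Not restated BY NAME in B4; its content reappears inside B4's
second proof of Prop. 2.3, pp. 593–594: *"Finally Corollary 2.3 implies that the considered operator is short-ranged in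
the sense that for some δ₀ > 0 (5.4) |(Δ^{(k)}(Ω,A) + aL^{−2}P(A))(x,x′)| ≤ c₀e^{−δ₀|x−x′|}, x, x′ ∈ Ω^{(k)}, and a change
of the domain Ω implies a change of the operator which can be estimated in the following way (5.5) |(Δ^{(k)}(Ω,A) −
Δ^{(k)}(Ω₀,A))(x,x′)| ≤ c₀e^{−δ₀(|x−x′| + dist(x,Ω^{(k)c}) + dist(x′,Ω^{(k)c}))}, Ω ⊂ Ω₀, x, x′ ∈ Ω^{(k)}"* ((5.5) = (2.29);
(5.4) = (2.27) for Δ^{(k)} + aL^{−2}P(A), P(A) of finite range; cell census C-B4-3) — typed here because it sits between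
the two cited propositions and fixes δΔ^{(k)} (2.28), the notation B4 (1.19)–(1.20)/(5.5) presupposes.
[cite: Balaban1982Higgs1, Prop. 2.2 (2.27)–(2.29) p.611] -/
def Prop22Literal (fam : I → DeltaSetting) : Prop :=
  ∃ δ₀ c₀ : ℝ, 0 < δ₀ ∧ 0 < c₀ ∧ ∀ i : I,
    (fam i).regular → (fam i).bigBlocks → Ineq227_229 (fam i) δ₀ c₀

/-- Prop. 2.2 under the INTENDED reading (the smallness "for e(L^kε) sufficiently small" inherited from Prop. 2.1, of
which it is printed as a consequence). [cite: Balaban1982Higgs1, Prop. 2.2 p.611 with Prop. 2.1 p.610] -/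
def Prop22Small (fam : I → DeltaSetting) : Prop :=
  ∃ δ₀ c₀ e₁ : ℝ, 0 < δ₀ ∧ 0 < c₀ ∧ 0 < e₁ ∧ ∀ i : I,
    (fam i).regular → (fam i).bigBlocks → 0 < (fam i).e → (fam i).e ≤ e₁ → Ineq227_229 (fam i) δ₀ c₀

/-- The literal (threshold-free) reading implies the intended one. [folklore] -/
theorem prop22Small_of_literal (fam : I → DeltaSetting) (h : Prop22Literal fam) : Prop22Small fam := by
  obtain ⟨δ₀, c₀, hδ, hc, hi⟩ := h
  exact ⟨δ₀, c₀, 1, hδ, hc, one_pos, fun i hr hb _ _ => hi i hr hb⟩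

/-! ## Proposition 2.3 (pp. 611–612): the unit-lattice covariances C^{(k)}_Λ(Ω, A) -/

/-- (2.33), (2.34), (2.36), (2.38) for one instance with constants (δ₀, c₀, γ₀, γ₁), in the printed order — the same four
clauses, in the same order, as B4 (1.15), (1.16), (1.18), (1.20) over `B4.UnitSetting` ((2.35) = (1.17), (2.37) = (1.19)
are the definitions of δC^{(k)}_Λ(Ω,A), δC^{(k)}_Λ(Ω,Ω₀,A) named by the fields `kerDC`, `kerDC0`).
[cite: Balaban1982Higgs1, (2.33)–(2.38) pp.611–612] -/
def Ineq233_238 (S : B4.UnitSetting) (δ₀ c₀ γ₀ γ₁ : ℝ) : Prop :=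
  S.form115 γ₀ γ₁ ∧
  (∀ x x' : S.LSite, S.kerC x x' ≤ c₀ * Real.exp (-(δ₀ * S.udist x x'))) ∧
  (∀ x x' : S.LSite, S.kerDC x x' ≤ c₀ * Real.exp (-(δ₀ * (S.udist x x' + S.distLc x + S.distLc x')))) ∧
  (∀ x x' : S.LSite, S.kerDC0 x x' ≤ c₀ * Real.exp (-(δ₀ * (S.udist x x' + S.distOc x + S.distOc x'))))

/-- **Proposition 2.3** (pp. 611–612 [PDF 9–10], verbatim from the render; preceded by (2.30) C^{(k),L^kε}(Ω,A) =
(a(L^{k+1}ε)^{−2}P(A) + Δ^{(k),L^kε}(Ω,A))^{−1}, (2.31) C^{(k)}(Ω,A) = (aL^{−2}P(A) + Δ^{(k)}(Ω,A))^{−1}, *"It is not clear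
from the formulas (2.30), (2.31) that the covariances are well defined. It is so, and it is one of the assertions of
Proposition 2.3"*, (2.32) C^{(k)}_Λ(Ω,A) = ((aL^{−2}P(A) + Δ^{(k)}(Ω,A))↾_Λ)^{−1}, A↾_Λφ = ΛAΛφ, *"Here we will assume that
the set Λ is a union of big blocks of T₁^{(k)}."*): *"If a configuration A is regular on Ω in the sense defined in
Proposition 2.1, then there exist positive constants δ₀, c₀, γ₀, γ₁, dependent on d and a, and independent of A, k, Ω
and Λ, such that γ₀I ≤ aL^{−2}P(A) + Δ^{(k)}(Ω,A) ≤ γ₁I, (2.33) |C^{(k)}_Λ(Ω,A;x,x′)| ≤ c₀ exp(−δ₀|x−x′|), x,x′ ∈ Λ. (2.34)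
In particular the above inequality holds for C^{(k)}(Ω,A). Putting δC^{(k)}_Λ(Ω,A) = C^{(k)}_Λ(Ω,A) − C^{(k)}(Ω,A), (2.35)
we have |δC^{(k)}_Λ(Ω,A;x,x′)| ≤ c₀ exp(−δ₀(|x−x′| + dist(x,Λᶜ) + dist(x′,Λᶜ))), x,x′ ∈ Λ. (2.36) Finally, for Ω ⊂ Ω₀ and
δC^{(k)}_Λ(Ω,Ω₀,A) = C^{(k)}_Λ(Ω,A) − C^{(k)}_Λ(Ω₀,A), (2.37) we have similarly |δC^{(k)}_Λ(Ω,Ω₀,A;x,x′)| ≤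
c₀ exp(−δ₀(|x−x′| + dist(x,Ω^{(k)c}) + dist(x′,Ω^{(k)c}))), x,x′ ∈ Λ. (2.38)"*  LITERAL typing: NO smallness clause on
e(L^kε) is printed (B4's restatement p. 574 adds "and for e sufficiently small" — DIVERGENCE D-pv07.2: B4 states and
proves the WEAKER statement; `prop23Printed_of_literal`); constants "dependent on d and a" (B4: "on d and M only") —
D-pv07.2, no typed effect. [cite: Balaban1982Higgs1, Prop. 2.3 (2.30)–(2.38) pp.611–612] -/
def Prop23Literal (fam : I → B4.UnitSetting) : Prop :=
  ∃ δ₀ c₀ γ₀ γ₁ : ℝ, 0 < δ₀ ∧ 0 < c₀ ∧ 0 < γ₀ ∧ 0 < γ₁ ∧ ∀ i : I,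
    (fam i).regular → (fam i).bigBlocks → Ineq233_238 (fam i) δ₀ c₀ γ₀ γ₁

/-- Prop. 2.3 under the INTENDED reading (smallness of e(L^kε) inherited from Prop. 2.1: "consequences of the above
theorem") — the quantifier shape of `B4.Prop23Printed`. [cite: Balaban1982Higgs1, Prop. 2.3 pp.611–612 with Prop. 2.1 p.610] -/
def Prop23Intended (fam : I → B4.UnitSetting) : Prop :=
  ∃ δ₀ c₀ γ₀ γ₁ e₁ : ℝ, 0 < δ₀ ∧ 0 < c₀ ∧ 0 < γ₀ ∧ 0 < γ₁ ∧ 0 < e₁ ∧ ∀ i : I,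
    (fam i).regular → (fam i).bigBlocks → 0 < (fam i).e → (fam i).e ≤ e₁ → Ineq233_238 (fam i) δ₀ c₀ γ₀ γ₁

/-- KERNEL-CHECKED COMPARISON (cell P00 target 1): under the DICTIONARY, B4's "Proposition 2.3 of [1]" p. 574 as typed
by b04 is B1's Prop. 2.3 in the intended reading, clause for clause ((2.33) ↔ (1.15) up to the printed order of the two
summands, named by the one carrier field `form115`). [folklore] -/
theorem prop23Intended_iff_prop23Printed (fam : I → B4.UnitSetting) :
    Prop23Intended fam ↔ B4.Prop23Printed fam :=
  Iff.rfl

/-- The literal B1 statement (no smallness clause) implies B4's restatement (any threshold, e.g. e₁ = 1, serves): B4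
restates — and proves — the weaker, intended statement (DIVERGENCE D-pv07.2). [folklore] -/
theorem prop23Printed_of_literal (fam : I → B4.UnitSetting) (h : Prop23Literal fam) : B4.Prop23Printed fam := by
  obtain ⟨δ₀, c₀, γ₀, γ₁, hδ, hc, hγ₀, hγ₁, hi⟩ := h
  exact ⟨δ₀, c₀, γ₀, γ₁, 1, hδ, hc, hγ₀, hγ₁, one_pos, fun i hr hb _ _ => hi i hr hb⟩

/-! ## (2.39)–(2.43) (p. 612): the renormalization-group recursion for the propagators -/

/-- **(2.42) ⇒ (2.43)** (p. 612 [PDF 10]), KERNEL-CHECKED as the telescoping it is.  Printed: *"Now we will find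
recursive relations between the propagators (2.20), (2.30). Using the relations (2.18), (2.19), (2.21), we get after
easy calculations Z^ε_{k+1}(Ω,A) = Z^ε_k(Ω,A)Z^{(k),L^kε}(Ω,A), (2.39) Z^ε_k(Ω,A) = Z^{(k−1),L^{k−1}ε}(Ω,A)·…·Z^{(1),Lε}(Ω,A)
Z^{(0),ε}(Ω,A), (2.40) Q_{k+1}(A)G^ε_{k+1}(Ω,A) = (aa_k/a_{k+1})(L^kε)^{−2}Q(A)C^{(k),L^kε}(Ω,A)Q_k(A)G^ε_k(Ω,A), (2.41)
G^ε_{k+1}(Ω,A) = a_k²(L^kε)^{−4}G^ε_k(Ω,A)Q_k^*(A)C^{(k),L^kε}(Ω,A)Q_k(A)G^ε_k(Ω,A) + G^ε_k(Ω,A). (2.42) … More exactly, an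
equality obtained by solving (2.42), i.e. applying (2.42) k times, has such a meaning. Using the identity G^ε_1(Ω,A) =
C^{(0),ε}(Ω,A), we get G^ε_k(Ω,A) = Σ_{j=1}^{k−1} a_j²(L^jε)^{−4}G^ε_j(Ω,A)Q_j^*(A)C^{(j),L^jε}(Ω,A)Q_j(A)G^ε_j(Ω,A) +
C^{(0),ε}(Ω,A). (2.43)"* — B4 p. 582 (2.34) imports (2.43) at A = 0 "rescaled to the η-lattice" (census G-B4-06(b)).
Typed over an arbitrary additive commutative monoid `R` of operators on the fields over Ω: `G j` = G^ε_j(Ω,A), `T j` =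
the j-th summand a_j²(L^jε)^{−4}G^ε_jQ_j^*C^{(j),L^jε}Q_jG^ε_j (opaque), `C0` = C^{(0),ε}(Ω,A); Σ_{j=1}^{k−1} =
`Finset.Ico 1 k`.  Only the step (2.42) ⇒ (2.43) is checked; (2.39)–(2.42) themselves ("easy calculations" from
(2.18), (2.19), (2.21)) are Gaussian-integral identities not modelled here. [cite: Balaban1982Higgs1, (2.39)–(2.43) p.612] -/
theorem display243_of_242 {R : Type} [AddCommMonoid R] (G T : ℕ → R) (C0 : R) (h1 : G 1 = C0)
    (h242 : ∀ j : ℕ, 1 ≤ j → G (j + 1) = T j + G j) (k : ℕ) (hk : 1 ≤ k) :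
    G k = (∑ j ∈ Finset.Ico 1 k, T j) + C0 := by
  induction k, hk using Nat.le_induction with
  | base => simp [h1]
  | succ n hn ih =>
    rw [h242 n hn, ih, Finset.sum_Ico_succ_top hn]
    abel

/-! ## ADDENDUM (gen 2, unit `b2b-balaban-pv07`, census G-B4-06 (a), (d)): the operator calculus of Sects. 1–3
imported by B4

SOURCE (×2 renders, pp. 605, 608–610, 614–615, 619–620 = PDF 3, 6–8, 12–13, 17–18), PRINTED VERBATIM.
p. 605: *"we introduce a representation of the additive group of real numbers R in unitary operators on R^N:
U(A) = exp(qεeA), A ∈ R, where e is a coupling constant and q is an antisymmetric N × N matrix. We will assume only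
that ‖q‖ ≤ 1. Antisymmetry of q implies U(A)^* = U(−A) = U(−A)^{−1}"* [so printed; U(A)^{−1} is meant] *". A covariant
derivative for scalar fields is defined by the formula (D^ε_Aφ)(b) = ε^{−1}(U(A_b)φ(b₊) − φ(b₋)), b = ⟨b₋,b₊⟩. (1.7)"*;
*"Here −Δ^ε_A = D^{ε*}_A D^ε_A is the covariant Laplace operator and −Δ^ε = ∂^{ε*}∂^ε is the Laplace operator on the
torus T_ε."*  p. 608: (2.1)–(2.2) fix, for y ∈ T^{(k)}_{L^kε} and x ∈ B^k(y), an oriented contour Γ^{(k)}_{y,x} from y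
to x (a concatenation Γ_{y,x_{k−1}} ∪ Γ_{x_{k−1},x_{k−2}} ∪ … ∪ Γ_{x₁,x} of one-step block contours); *"For an arbitrary
oriented contour Γ, let us put A(Γ) = Σ_{b⊂Γ} A_b, (2.3) where the bonds b are taken with the orientations according
to the orientation of Γ."*; *"(Q(A)φ)(y) = L^{−d} Σ_{x∈B(y)} U(A(Γ_{y,x}))φ(x). (2.7)"*.  p. 609: *"where Q_k(A) is an
operator transforming functions on the ε-lattice T_ε into functions on the L^kε-lattice T^{(k)}_{L^kε} and given by
the formula (Q_k(A)f)(y) = L^{−kd} Σ_{x∈B^k(y)} U(A(Γ^{(k)}_{y,x}))f(x), y ∈ T^{(k)}_{L^kε}. (2.11)"*; *"where a, a_k,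
a_{k+1} satisfy the relation a_{k+1} = aa_k/(aL^{−2} + a_k). (2.13)"*; *"A sequence of numbers a_k satisfying the above
recurrent equation and an initial condition a₁ = a is uniquely determined and it is equal to
a_k = a(1 − L^{−2})/(1 − L^{−2k}), a_k ↘ a_∞ = a(1 − L^{−2}) as k → ∞. (2.15)"*.  p. 610: *"G^ε_k(Ω,A) =
(−Δ^{ε,N}_{A,Ω} + m² + a_k(L^kε)^{−2}P_k(A))^{−1}, P_k(A) = Q_k^*(A)Q_k(A), (2.20)"*; *"G_k(Ω,A) = (−Δ^{η,N}_{A,Ω} +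
m²(L^kε)² + a_kP_k(A))^{−1}. (2.22)"* (η = L^{−k}).  p. 614: *"Thus we have the basic expansion for the function U(A)
rescaled to η-lattice U(A) = exp(ηqe(L^kε)A) = 1 + Σ_{n=1}^{n̄} (1/n!)(ηqe(L^kε)A)^n +
(1/(n̄+1)!)(ηqe(L^kε)A)^{n̄+1} R_{n̄+1}(ηqe(L^kε)A) =: 1 + ηF_{1,k}(A) =: 1 + F′_{1,k}(A), (3.14) where e(L^kε) =
e(L^kε)^{(4−d)/2}"* [so printed] *"and R_{n̄+1}(z) is an analytic function of z defined by the formula R_{n̄+1}(z) =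
(n̄+1)∫₀¹(1−t)^{n̄}e^{tz}dt. This implies an expansion of the operator Q_k(A+B)
(Q_k(A+B)φ)(y) = L^{−kd} Σ_{x∈B^k(y)} U((A+B)(Γ^{(k)}_{y,x}))φ(x) = (Q_k(B)φ)(y) +
L^{−kd} Σ_{x∈B^k(y)} F′_{1,k}(A(Γ^{(k)}_{y,x}))U(B(Γ^{(k)}_{y,x}))φ(x) =: (Q_k(B)φ)(y) + (F_{2,k}(A,B)φ)(y). (3.15)"*
p. 615: *"The above two formulas imply an expansion of the covariant Laplace operator with the Neumann boundary
conditions on arbitrary Ω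
−Δ^{η,N}_{A+B,Ω} + a_kP_k(A+B) = −Δ^{η,N}_{B,Ω} − F_{1,k}(−A)^*D^η_B − D^{η*}_B F_{1,k}(−A) + F_{1,k}(−A)^*F_{1,k}(−A)
+ a_kP_k(B) + a_kF_{2,k}(A,B)^*Q_k(B) + a_kQ_k^*(B)F_{2,k}(A,B) + a_kF_{2,k}(A,B)^*F_{2,k}(A,B). (3.16)"*; ibid.
*"we can estimate the terms containing the matrix R_{n̄+1}(·) using the inequality |R_{n̄+1}(qA)| ≤ 1, which holds
for arbitrary real A"*.  p. 619: *"and we expand the action with respect to A′^{(k)}. This expansion was described in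
the formulas (3.19), (3.15), and (3.16). Let us write only the resulting expansion of the propagator G_k(Ω,A+B):
G_k(Ω,A+B) = G_k(Ω,B) + G_k(Ω,B)[F_{1,k}(−A)^*D^η_B + D^{η*}_B F_{1,k}(−A) − F_{1,k}(−A)^*F_{1,k}(−A) −
a_kF_{2,k}(A,B)^*Q_k(B) − a_kQ_k^*(B)F_{2,k}(A,B) − a_kF_{2,k}(A,B)^*F_{2,k}(A,B)]G_k(Ω,A+B). (3.44)"*  p. 620: *"Let
us denote the operator in the square bracket in (3.44) by V_k. Applying the formula (3.44) n̄ times we get the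
expansion G_k(Ω,A+B) = Σ_{n=0}^{n̄} G_k(Ω,B)[V_kG_k(Ω,B)]^n + G_k(Ω,B)[V_kG_k(Ω,B)]^{n̄}V_kG_k(Ω,A+B). (3.45)"*.
B4 CONSUMERS [Balaban1983RegularityDecay]: (1.4) p. 572 *"(Q_k(A)φ)(y) = Σ_{x∈B^k(y)} η^d U(A(Γ^{(k)}_{y,x}))φ(x)"*
(η^d = L^{−kd}: the weight of (2.11)); (1.5) P_k(A) = Q_k^*(A)Q_k(A); (1.6) *"G_k(Ω,A) = (−Δ^{η,N}_{A,Ω} + m² +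
aP_k(A))^{−1}, where m² ≥ 0 and a is a positive constant close to 1"*; p. 579 (2.24) *"Using formula I.3.16 we have
G_k^{1/2}(□,A₀)(−Δ^{η,N}_{A,□} + m_k² + a_kP_k(A))G_k^{1/2}(□,A₀) = I − G_k^{1/2}(□,A₀)[F_{1,k}(−A′)^*D^η_{A₀} +
D^{η*}_{A₀}F_{1,k}(−A′) − F_{1,k}(−A′)^*F_{1,k}(−A′) − a_kF_{2,k}(A′,A₀)^*Q_k(A₀) − a_kQ_k^*(A₀)F_{2,k}(A′,A₀) −
a_kF_{2,k}(A′,A₀)^*F_{2,k}(A′,A₀)]G_k^{1/2}(□,A₀)"* (A = A₀ + A′); p. 580 *"F_{1,k}(A) = η^{−1}(U(A) − 1)"*,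
*"(F_{2,k}(A′,A₀)φ)(y) = Σ_{x∈B^k(y)} η^d F′_{1,k}(A′(Γ^{(k)}_{y,x}))U(A₀(Γ^{(k)}_{y,x}))φ(x), F′_{1,k}(A) = U(A) − 1"*,
*"D^η_A = U(A′)D^η_{A₀} + F_{1,k}(A′)"*; p. 590 *"using (I.3.15), (I.3.44)"*.
WHAT IS KERNEL-CHECKED is listed in the module docstring's ADDENDUM paragraph; each theorem's docstring gives the
dictionary abstract symbol ↤ printed object.  Nothing of the paper is asserted. -/

/-! ### (2.13)–(2.15) p. 609: the sequence a_k -/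

/-- (2.15) p. 609 [PDF 7] as a closed form for all k: a_k = a(1 − L^{−2})/(1 − L^{−2k}) (here with r := (L²)⁻¹, r^k =
L^{−2k}); the paper's sequence starts at a₁ = a — at k = 0 the denominator vanishes and the value is Lean's junk 0.
[cite: Balaban1982Higgs1, (2.15) p.609] -/
noncomputable def aSeq (a L : ℝ) (k : ℕ) : ℝ := a * (1 - (L ^ 2)⁻¹) / (1 - ((L ^ 2)⁻¹) ^ k)

/-- Unfolding lemma for `aSeq` (definitional). [cite: Balaban1982Higgs1, (2.15) p.609] -/
theorem aSeq_eq (a L : ℝ) (k : ℕ) : aSeq a L k = a * (1 - (L ^ 2)⁻¹) / (1 - ((L ^ 2)⁻¹) ^ k) := rfl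

/-- 0 < L^{−2} < 1 for L > 1 (elementary). [folklore] -/
private theorem r_bounds {L : ℝ} (hL : 1 < L) : 0 < (L ^ 2)⁻¹ ∧ (L ^ 2)⁻¹ < 1 := by
  have h2 : 1 < L ^ 2 := by nlinarith
  exact ⟨by positivity, inv_lt_one_of_one_lt₀ h2⟩

/-- (2.15) satisfies the initial condition a₁ = a. KERNEL. [cite: Balaban1982Higgs1, (2.15) p.609] -/
theorem aSeq_one {a L : ℝ} (hL : 1 < L) : aSeq a L 1 = a := by
  obtain ⟨_, hr1⟩ := r_bounds hL
  rw [aSeq_eq, pow_one, mul_div_assoc, div_self (by linarith), mul_one]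

/-- (2.15) satisfies the recurrence (2.13) *"a_{k+1} = aa_k/(aL^{−2} + a_k)"* for k ≥ 1. KERNEL.
[cite: Balaban1982Higgs1, (2.13) p.609] -/
theorem aSeq_succ {a L : ℝ} (ha : 0 < a) (hL : 1 < L) {k : ℕ} (hk : 1 ≤ k) :
    aSeq a L (k + 1) = a * aSeq a L k / (a * (L ^ 2)⁻¹ + aSeq a L k) := by
  obtain ⟨hr0, hr1⟩ := r_bounds hL
  simp only [aSeq_eq]
  set r := (L ^ 2)⁻¹ with hr
  have hk' : r ^ k < 1 := pow_lt_one₀ hr0.le hr1 (by omega)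
  have hk1 : r ^ (k + 1) < 1 := pow_lt_one₀ hr0.le hr1 (by omega)
  have h1 : (1 : ℝ) - r ^ k ≠ 0 := by linarith
  have h2 : (1 : ℝ) - r ^ (k + 1) ≠ 0 := by linarith
  have h3 : (1 : ℝ) - r ≠ 0 := by linarith
  have hden : a * r + a * (1 - r) / (1 - r ^ k) = a * (1 - r ^ (k + 1)) / (1 - r ^ k) := by
    field_simp
    ring
  rw [hden]
  field_simp

/-- (2.15) p. 609: *"A sequence of numbers a_k satisfying the above recurrent equation and an initial condition a₁ = a
is uniquely determined and it is equal to a_k = a(1 − L^{−2})/(1 − L^{−2k})"* — KERNEL (induction from k = 1).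
[cite: Balaban1982Higgs1, (2.13)–(2.15) p.609] -/
theorem aSeq_unique {a L : ℝ} (ha : 0 < a) (hL : 1 < L) (b : ℕ → ℝ) (hb1 : b 1 = a)
    (hrec : ∀ k, 1 ≤ k → b (k + 1) = a * b k / (a * (L ^ 2)⁻¹ + b k)) :
    ∀ k, 1 ≤ k → b k = aSeq a L k := by
  intro k hk
  induction k, hk using Nat.le_induction with
  | base => rw [hb1, aSeq_one hL]
  | succ n hn ih => rw [hrec n hn, ih, aSeq_succ ha hL hn]

/-- a_k > 0 for k ≥ 1 (a > 0, L > 1). KERNEL. [cite: Balaban1982Higgs1, (2.15) p.609] -/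
theorem aSeq_pos {a L : ℝ} (ha : 0 < a) (hL : 1 < L) {k : ℕ} (hk : 1 ≤ k) : 0 < aSeq a L k := by
  obtain ⟨hr0, hr1⟩ := r_bounds hL
  have hk' : ((L ^ 2)⁻¹) ^ k < 1 := pow_lt_one₀ hr0.le hr1 (by omega)
  rw [aSeq_eq]
  apply div_pos (mul_pos ha (by linarith)) (by linarith)

/-- (2.15) *"a_k ↘"*: strictly decreasing from k = 1 on. KERNEL. [cite: Balaban1982Higgs1, (2.15) p.609] -/
theorem aSeq_succ_lt {a L : ℝ} (ha : 0 < a) (hL : 1 < L) {k : ℕ} (hk : 1 ≤ k) :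
    aSeq a L (k + 1) < aSeq a L k := by
  obtain ⟨hr0, hr1⟩ := r_bounds hL
  simp only [aSeq_eq]
  set r := (L ^ 2)⁻¹ with hr
  have hk' : r ^ k < 1 := pow_lt_one₀ hr0.le hr1 (by omega)
  have hlt : r ^ (k + 1) < r ^ k := by
    rw [pow_succ]
    exact mul_lt_of_lt_one_right (pow_pos hr0 k) hr1
  apply div_lt_div_of_pos_left (mul_pos ha (by linarith)) (by linarith) (by linarith)

/-- (2.15) *"a_k ↘ a_∞ = a(1 − L^{−2})"*: the limit is a strict lower bound for every k ≥ 1. KERNEL.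
[cite: Balaban1982Higgs1, (2.15) p.609] -/
theorem ainf_lt_aSeq {a L : ℝ} (ha : 0 < a) (hL : 1 < L) (k : ℕ) (hk : 1 ≤ k) :
    a * (1 - (L ^ 2)⁻¹) < aSeq a L k := by
  obtain ⟨hr0, hr1⟩ := r_bounds hL
  rw [aSeq_eq]
  have hpk : 0 < ((L ^ 2)⁻¹) ^ k := pow_pos hr0 k
  have hk' : ((L ^ 2)⁻¹) ^ k < 1 := pow_lt_one₀ hr0.le hr1 (by omega)
  rw [lt_div_iff₀ (by linarith)]
  nlinarith [mul_pos ha (by linarith : (0:ℝ) < 1 - (L ^ 2)⁻¹)]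

/-- a_k ≤ a = a₁ for k ≥ 1 (so, with B4 (1.6)'s *"a is a positive constant close to 1"*, every a_k lies in
]a(1 − L^{−2}), a]). KERNEL. [cite: Balaban1982Higgs1, (2.15) p.609] -/
theorem aSeq_le {a L : ℝ} (ha : 0 < a) (hL : 1 < L) (k : ℕ) (hk : 1 ≤ k) : aSeq a L k ≤ a := by
  obtain ⟨hr0, hr1⟩ := r_bounds hL
  rw [aSeq_eq]
  have hk' : ((L ^ 2)⁻¹) ^ k < 1 := pow_lt_one₀ hr0.le hr1 (by omega)
  have hle : ((L ^ 2)⁻¹) ^ k ≤ (L ^ 2)⁻¹ := pow_le_of_le_one hr0.le hr1.le (by omega)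
  rw [div_le_iff₀ (by linarith)]
  nlinarith

/-- (2.15) *"a_k ↘ a_∞ = a(1 − L^{−2}) as k → ∞"*: the convergence. KERNEL. [cite: Balaban1982Higgs1, (2.15) p.609] -/
theorem tendsto_aSeq (a : ℝ) {L : ℝ} (hL : 1 < L) :
    Filter.Tendsto (aSeq a L) Filter.atTop (nhds (a * (1 - (L ^ 2)⁻¹))) := by
  obtain ⟨hr0, hr1⟩ := r_bounds hL
  have h : Filter.Tendsto (fun k : ℕ => ((L ^ 2)⁻¹) ^ k) Filter.atTop (nhds 0) :=
    tendsto_pow_atTop_nhds_zero_of_lt_one hr0.le hr1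
  have h2 : Filter.Tendsto (fun k : ℕ => 1 - ((L ^ 2)⁻¹) ^ k) Filter.atTop (nhds (1 - 0)) :=
    h.const_sub 1
  have h3 := (tendsto_const_nhds (x := a * (1 - (L ^ 2)⁻¹)) (f := (Filter.atTop : Filter ℕ))).div h2
    (by norm_num)
  rw [sub_zero, div_one] at h3
  exact h3

/-! ### (2.7) p. 608, (2.11) p. 609 (= B4 (1.4)): the averaging operators; (3.15) p. 614 -/

/-- The common shape of (2.7) *"(Q(A)φ)(y) = L^{−d} Σ_{x∈B(y)} U(A(Γ_{y,x}))φ(x)"*, (2.11) *"(Q_k(A)f)(y) =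
L^{−kd} Σ_{x∈B^k(y)} U(A(Γ^{(k)}_{y,x}))f(x)"* and B4 (1.4) (weight η^d = L^{−kd}, η = L^{−k}: the same number): a
weighted block sum of parallel-transported values.  DICTIONARY: `X` ↤ sites of the fine lattice (T_ε, resp. T_η),
`Y` ↤ sites of the block lattice T^{(k)}_{L^kε}, `blk y` ↤ the block B^k(y) (a `Finset X`), `hol y x` ↤ the matrix
U(A(Γ^{(k)}_{y,x})) acting on `V` ↤ R^N (for the operator F_{2,k}(A,B) of (3.15): F′_{1,k}(A(Γ))U(B(Γ))), `w` ↤ the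
weight L^{−d} / L^{−kd}.  P_k(A) = Q_k^*(A)Q_k(A) (2.20) and the propagators G_k of (2.20)/(2.22) are not given
separate carriers: they enter the identities below as elements of an abstract operator ring.
[cite: Balaban1982Higgs1, (2.7) p.608; (2.11) p.609] -/
def blockAvg {X Y V : Type} [AddCommMonoid V] [Module ℝ V] (w : ℝ) (blk : Y → Finset X)
    (hol : Y → X → V →ₗ[ℝ] V) (f : X → V) : Y → V :=
  fun y => w • ∑ x ∈ blk y, hol y x (f x)

/-- **(3.15)** p. 614, KERNEL-CHECKED as the pointwise identity it is.  Hypotheses = the paper's reasons: `hgroup` ↤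
U((A+B)(Γ)) = U(A(Γ))U(B(Γ)) for every contour Γ = Γ^{(k)}_{y,x} ((2.3) is additive in the field and U is a
representation of (R,+), p. 605); `h314` ↤ U(A(Γ)) = 1 + F′_{1,k}(A(Γ)) ((3.14): F′_{1,k} := U − 1, restated by B4
p. 580).  Conclusion ↤ Q_k(A+B)φ = Q_k(B)φ + F_{2,k}(A,B)φ with (F_{2,k}(A,B)φ)(y) =
L^{−kd} Σ_{x∈B^k(y)} F′_{1,k}(A(Γ^{(k)}_{y,x}))U(B(Γ^{(k)}_{y,x}))φ(x). [cite: Balaban1982Higgs1, (3.15) p.614] -/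
theorem display315 {X Y V : Type} [AddCommGroup V] [Module ℝ V] (w : ℝ) (blk : Y → Finset X)
    (holA holB holAB F' : Y → X → V →ₗ[ℝ] V)
    (hgroup : ∀ y x, holAB y x = holA y x ∘ₗ holB y x)
    (h314 : ∀ y x, holA y x = LinearMap.id + F' y x) (φ : X → V) :
    blockAvg w blk holAB φ = blockAvg w blk holB φ + blockAvg w blk (fun y x => F' y x ∘ₗ holB y x) φ := by
  funext y
  simp only [blockAvg, Pi.add_apply, hgroup, h314, LinearMap.comp_apply, LinearMap.add_apply,
    LinearMap.id_apply, Finset.sum_add_distrib, smul_add]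

/-! ### (3.16) p. 615, (3.44) p. 619, (3.45) p. 620 and B4 (2.24) p. 579: operator identities in an abstract *-ring -/

/-- **(3.16)** p. 615, KERNEL-CHECKED as an identity in an arbitrary *-ring `𝔄` (↤ operators on (site fields on Ω) ⊕
(bond fields on Ω), `star` ↤ adjoint; −Δ^{η,N}_{X,Ω} = D^{η*}_X D^η_X with the sum over the bonds b ⊂ Ω — p. 605 and
B4 (1.5)).  DICTIONARY: `dB` ↤ D^η_B, `dAB` ↤ D^η_{A+B}; `w` ↤ multiplication of bond fields by U(A_b), unitary
(`hw`, `hw'`; p. 605 *"unitary operators"*); `f1` ↤ φ ↦ (b ↦ F_{1,k}(A_b)φ(b₋)), `f1m` ↤ the same with F_{1,k}(−A_b);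
`hD` ↤ D^η_{A+B} = U(A)D^η_B + F_{1,k}(A) bondwise (from (1.7), U((A+B)_b) = U(A_b)U(B_b) and U(A_b) = 1 +
ηF_{1,k}(A_b); it is B4's sentence *"D^η_A = U(A′)D^η_{A₀} + F_{1,k}(A′)"*, p. 580); `hwf` ↤ U(−A_b)F_{1,k}(A_b) =
−F_{1,k}(−A_b) (from F_{1,k}(A) = η^{−1}(U(A) − 1) and U(−A)U(A) = 1); `qB` ↤ Q_k(B), `qAB` ↤ Q_k(A+B), `f2` ↤
F_{2,k}(A,B), `hQ` ↤ (3.15); `a` ↤ a_k (a scalar in print; any ring element here); P_k(X) = Q_k^*(X)Q_k(X) (2.20).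
Conclusion ↤ (3.16), term by term in the printed order. [cite: Balaban1982Higgs1, (3.16) p.615] -/
theorem display316 {𝔄 : Type} [Ring 𝔄] [StarRing 𝔄] (a dB dAB w f1 f1m qB qAB f2 : 𝔄)
    (hw : star w * w = 1) (hw' : w * star w = 1) (hD : dAB = w * dB + f1) (hwf : star w * f1 = -f1m)
    (hQ : qAB = qB + f2) :
    star dAB * dAB + a * (star qAB * qAB) =
      star dB * dB - star f1m * dB - star dB * f1m + star f1m * f1m + a * (star qB * qB)
        + a * (star f2 * qB) + a * (star qB * f2) + a * (star f2 * f2) := by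
  have h1 : star f1 * w = -star f1m := by
    have := congrArg star hwf
    simpa [star_mul, star_star, star_neg] using this
  have h2 : star f1 * f1 = star f1m * f1m := by
    have e : f1m = -(star w * f1) := by rw [hwf, neg_neg]
    rw [e, star_neg, star_mul, star_star, neg_mul_neg, mul_assoc, ← mul_assoc w, hw', one_mul]
  have t1 : star dB * star w * (w * dB) = star dB * dB := by
    rw [mul_assoc, ← mul_assoc (star w), hw, one_mul]
  have t2 : star dB * star w * f1 = -(star dB * f1m) := by rw [mul_assoc, hwf, mul_neg]
  have t3 : star f1 * (w * dB) = -(star f1m * dB) := by rw [← mul_assoc, h1, neg_mul]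
  subst hD
  subst hQ
  simp only [star_add, star_mul, add_mul, mul_add, t1, t2, t3, h2]
  abel

/-- The resolvent identity (pure ring algebra): if G_B is a left inverse of H_B, G_{A+B} a right inverse of H_{A+B}
and H_{A+B} = H_B − V, then G_{A+B} = G_B + G_B V G_{A+B}.  KERNEL; the engine of (3.44). [folklore] -/
theorem resolvent_of_diff {𝔄 : Type} [Ring 𝔄] (hB hAB gB gAB v : 𝔄) (hgB : gB * hB = 1)
    (hgAB : hAB * gAB = 1) (hdiff : hAB = hB - v) : gAB = gB + gB * v * gAB := by
  have hv : v = hB - hAB := by rw [hdiff]; abel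
  have key : gB * v * gAB = gAB - gB := by
    rw [hv, mul_sub, sub_mul, hgB, one_mul, mul_assoc gB hAB gAB, hgAB, mul_one]
  rw [key]
  abel

/-- **(3.44) ⇐ (3.16)** p. 619, KERNEL-CHECKED in an arbitrary *-ring.  DICTIONARY as in `display316`, plus `μ` ↤
m²(L^kε)² (added on both sides of (3.16)), `gB` ↤ G_k(Ω,B) and `gAB` ↤ G_k(Ω,A+B) = the inverses (2.22) of
H_X := −Δ^{η,N}_{X,Ω} + m²(L^kε)² + a_kP_k(X), X = B, A+B (`hgB`, `hgAB`: one-sided inverses suffice).  Conclusion ↤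
(3.44) with the printed square bracket V_k = F_{1,k}(−A)^*D^η_B + D^{η*}_B F_{1,k}(−A) − F_{1,k}(−A)^*F_{1,k}(−A) −
a_kF_{2,k}(A,B)^*Q_k(B) − a_kQ_k^*(B)F_{2,k}(A,B) − a_kF_{2,k}(A,B)^*F_{2,k}(A,B) (= −(H_{A+B} − H_B) by (3.16)).
[cite: Balaban1982Higgs1, (3.44) p.619; (3.16) p.615; (2.22) p.610] -/
theorem display344_of_316 {𝔄 : Type} [Ring 𝔄] [StarRing 𝔄] (a μ dB dAB w f1 f1m qB qAB f2 gB gAB : 𝔄)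
    (hw : star w * w = 1) (hw' : w * star w = 1) (hD : dAB = w * dB + f1) (hwf : star w * f1 = -f1m)
    (hQ : qAB = qB + f2)
    (hgB : gB * (star dB * dB + μ + a * (star qB * qB)) = 1)
    (hgAB : (star dAB * dAB + μ + a * (star qAB * qAB)) * gAB = 1) :
    gAB = gB + gB * (star f1m * dB + star dB * f1m - star f1m * f1m - a * (star f2 * qB)
      - a * (star qB * f2) - a * (star f2 * f2)) * gAB := by
  refine resolvent_of_diff (star dB * dB + μ + a * (star qB * qB))
    (star dAB * dAB + μ + a * (star qAB * qAB)) gB gAB _ hgB hgAB ?_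
  have h316 := display316 a dB dAB w f1 f1m qB qAB f2 hw hw' hD hwf hQ
  have e : star dAB * dAB + μ + a * (star qAB * qAB) = (star dAB * dAB + a * (star qAB * qAB)) + μ := by
    abel
  rw [e, h316]
  abel

/-- **(3.45) ⇐ (3.44)** p. 620, KERNEL: iterating g = h + hvg in a ring gives, for EVERY n̄,
g = Σ_{n=0}^{n̄} h(vh)^n + h(vh)^{n̄}vg (the printed identity; it is the (n̄+1)-fold substitution — the printed *"n̄
times"* counts the substitutions after (3.44) itself).  DICTIONARY: `h` ↤ G_k(Ω,B), `g` ↤ G_k(Ω,A+B), `v` ↤ V_k.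
[cite: Balaban1982Higgs1, (3.45) p.620] -/
theorem display345_of_344 {𝔄 : Type} [Ring 𝔄] (h g v : 𝔄) (h344 : g = h + h * v * g) (nbar : ℕ) :
    g = (∑ n ∈ Finset.range (nbar + 1), h * (v * h) ^ n) + h * (v * h) ^ nbar * v * g := by
  induction nbar with
  | zero => simpa using h344
  | succ N ih =>
    have step : h * (v * h) ^ N * v * g = h * (v * h) ^ (N + 1) + h * (v * h) ^ (N + 1) * v * g := by
      conv_lhs => rw [h344]
      rw [pow_succ]
      noncomm_ring
    rw [Finset.sum_range_succ, add_assoc, ← step]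
    exact ih

/-- **B4 (2.24) ⇐ (3.16)** (B4 p. 579: *"Using formula I.3.16 we have (2.24)"*), KERNEL-CHECKED in an arbitrary
*-ring: (3.16) at (A,B) := (A′,A₀), A = A₀ + A′, the mass m_k² added on both sides, sandwiched by `s` ↤ G_k^{1/2}(□,A₀)
with s·H_{A₀}·s = I (`hs`; H_{A₀} := −Δ^{η,N}_{A₀,□} + m_k² + a_kP_k(A₀)).  DICTIONARY otherwise as in `display316`
with (dB, dAB, qB, qAB) renamed (dA0, dA, qA0, qA).  Conclusion ↤ B4 (2.24) with its printed square bracket — which is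
therefore exactly the V_k of (3.44) (signs agree term by term; cell certification C-pv07-3).
[cite: Balaban1983RegularityDecay, (2.24) p.579; Balaban1982Higgs1, (3.16) p.615] -/
theorem B4display224_of_316 {𝔄 : Type} [Ring 𝔄] [StarRing 𝔄] (a μ dA0 dA w f1 f1m qA0 qA f2 s : 𝔄)
    (hw : star w * w = 1) (hw' : w * star w = 1) (hD : dA = w * dA0 + f1) (hwf : star w * f1 = -f1m)
    (hQ : qA = qA0 + f2)
    (hs : s * (star dA0 * dA0 + μ + a * (star qA0 * qA0)) * s = 1) :
    s * (star dA * dA + μ + a * (star qA * qA)) * s =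
      1 - s * (star f1m * dA0 + star dA0 * f1m - star f1m * f1m - a * (star f2 * qA0)
        - a * (star qA0 * f2) - a * (star f2 * f2)) * s := by
  have h316 := display316 a dA0 dA w f1 f1m qA0 qA f2 hw hw' hD hwf hQ
  have e : star dA * dA + μ + a * (star qA * qA) =
      (star dA0 * dA0 + μ + a * (star qA0 * qA0)) - (star f1m * dA0 + star dA0 * f1m
        - star f1m * f1m - a * (star f2 * qA0) - a * (star qA0 * f2) - a * (star f2 * f2)) := by
    have e' : star dA * dA + μ + a * (star qA * qA) = (star dA * dA + a * (star qA * qA)) + μ := by abel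
    rw [e', h316]
    abel
  rw [e, mul_sub, sub_mul, hs]

end Literature.MathematicalPhysics.QuantumFieldTheory.Balaban1983to89.B1
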